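import Summits.QuantumFields.BalabanUV.Beta.WilsonJetDivergence
import Summits.QuantumFields.BalabanUV.Beta.WilsonStencilReflection
import Literature.MathematicalPhysics.QuantumFieldTheory.Balaban1983to89.Beta.PlaquetteBackground

/-!
# The background-gauge WARD (divergence) law of the antisymmetrised Wilson stencil on a finite lattice

HONEST FRAMING (cell charter, verbatim): «discharging `BetaPertH` makes Bałaban's UV stability UNCONDITIONAL — a real
constructive-QFT result; it is NOT the continuum limit and NOT the Clay problem.»  DERIVED cell leaf (pub-balaban β sub-cell, D1
formalisation swarm seat `b2b-balaban-beta-d1-formalise-leaf-05`, gen 2; leaf (W-LS0-E) «the Wilson Ward law» of an1-g25's hW skeleton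
`HOME/b2b-balaban-beta-an1-g25/SKELETON-D1-hW.v1.md` §2 (W-LS)_0, stage 2 of 3 = the FINITE-LATTICE law): finite-dimensional linear
algebra over an arbitrary finite abelian lattice, no estimate, no limit, nothing cited — every statement is kernel-proved here
([folklore] = standard finite algebra, no published theorem is quoted); no `[cite:]` tag, no `def … : Prop`; it instantiates NO binder of
the β-function wall.  NOT `BetaPertH`, NOT continuum, NOT Clay.
HONEST DEPENDENCY (cell records, verbatim): «continuum YM on T⁴ ⇐ BetaPertH ∧ nine spine estimates (0/9 proved); BetaPertH ⇐ (D1) ∧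
(D4) ∧ CAP+tail; G-an2-4 gates asym, D1 and NE2/3/4.»
ABSOLUTE RULE (cell charter, verbatim): «No internally-minted statement may enter as a cited fact. Every hypothesis is either
kernel-proved in this package or a verbatim quotation of a PUBLISHED theorem with page reference. The manuscript(s) under audit are
NOT citable for their own disputed steps — they are the thing under adjudication; programme-internal (2001/route/tribunal) claims are
never citable.»

THE CHAIN (the twin of an3's `WilsonStencilReflection` for the DIVERGENCE instead of the reflection).  `WilsonJetDivergence.jet21_grad`
(the `(2,1)`-jet at the pure gauge `grad (ℓ • Y)` is the polarised `(2,0)`-jet in the direction `adj (ℓ • Y) W`) is read, for the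
coordinate field `W = field t v`, through an3's every-background headline `PlaquetteBackground.actionJet21_eq_wilsonVertexOp` on the left
(`lhs_coords`) and through `PlaquetteVertex.lcurl_field` + `WilsonStencilReflection.trace_comb_mul_comm` on the right
(`rhs_coords`) ⇒ the QUADRATIC-FORM WARD LAW `quadratic_ward_law`:
`Σ_z Σ_γ (ℓ(z + e_γ) − ℓ z) · v ⬝ᵥ W(z, γ, adM Y) v = Σ_x Σ_μν Σ_a (lcurl v)_a · Σ_b (adM Y)_{ab} (lcurl (ℓ ⊙ v))_b`.
At the test vector `cvec a δ_p + cvec b δ_q` (`WilsonReflectionFrame`) this is the ENTRYWISE LAW WITH COLOUR (`entry_ward_law_colour`, a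
multiple of `(adM Y)_{ab}`); the curl–curl matrix is twice an3's contact coefficient (`curlCurl_eq_two_mul_Lc`:
`Σ_x Σ_{μν} lcurl δ_p · lcurl δ_q = 2 · WilsonReflectionFrame.Lc e q.2 q.1 p`); and the non-degenerate quaternion witness
`WilsonStencilReflection.adM_witnessH` strips the colour:

**`S₀A_grad : Σ_z Σ_γ (ℓ(z + e_γ) − ℓ z) · S₀A e z γ p q = (ℓ q.1 − ℓ p.1) · Lc e q.2 q.1 p`**, and at one site
**`S₀A_div : Σ_γ (S₀A e (u − e_γ) γ p q − S₀A e u γ p q) = ([q.1 = u] − [p.1 = u]) · Lc e q.2 q.1 p`**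

— on every finite abelian lattice with frame `e`: the antisymmetrised colourless Wilson stencil (`WilsonReflectionFrame.S₀A`; on `ℤ^(d+1)`
its entries are an2's `StepJetData.wilsonA` field block) contracted with the pure-gauge mode of the site `u` is the generator of the gauge
rotation at `u` acting on the two legs AT THEIR SITES through the curl–curl contact, with coefficient ONE HALF of the curl–curl matrix
entry `2·Lc`.  The transfer to `ℤ^(d+1)` (an2's `KernelWard.divV`, `ChartConjugation.conjV`, `BorderedHessian.diagK` / `bhKAt`, leaf-10's
socket `WardLocusS0N.hSd_S0NAt_of_wilsonWard` and its lock `cE' = 1/2`) is the sequel module `WilsonDivergenceContact` (not here).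
-/

namespace Summit.QuantumFields.BalabanUV.Beta.WilsonStencilDivergence

open Finset
open scoped BigOperators Matrix
open Literature.MathematicalPhysics.QuantumFieldTheory.Balaban1983to89.Beta.PlaquetteVertex
open Literature.MathematicalPhysics.QuantumFieldTheory.Balaban1983to89.Beta.PlaquetteStencil (wilsonVertex₁
  actionJet21_eq_wilsonVertex₁ dotProduct_sum_mulVec)
open Literature.MathematicalPhysics.QuantumFieldTheory.Balaban1983to89.Beta.PlaquetteBackground (wilsonVertexOp
  actionJet21_eq_wilsonVertexOp)
open Literature.MathematicalPhysics.QuantumFieldTheory.Balaban1983to89.Beta.WilsonVertexKron (wilsonStencil₀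
  wilsonVertex₁_apply_eq_mul)
open Summit.QuantumFields.BalabanUV.Beta.WilsonReflectionFrame
open Summit.QuantumFields.BalabanUV.Beta.WilsonStencilReflection (trace_comb_mul_comm tH YH τH τH_comm adM_witnessH)
open Summit.QuantumFields.BalabanUV.Beta.WilsonJetDivergence

/-! ## §0 The objects -/

section Defs

/-- [folklore] THE SITE-WEIGHTED COORDINATES `(ℓ ⊙ v)(x,(a,k)) := ℓ x · v(x,(a,k))`.  A definition asserting nothing. -/
def siteMul {Λ : Type*} {C : Type*} {D : Type*} (ell : Λ → ℝ) (v : Λ × (C × D) → ℝ) : Λ × (C × D) → ℝ := fun P => ell P.1 * v P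

/-- [folklore] THE CURL–CURL MATRIX of a finite lattice: `curlCurl e p q := Σ_x Σ_μ Σ_ν lcurl δ_p (x;μ,ν) · lcurl δ_q (x;μ,ν)` (over ORDERED
direction pairs; the matrix of the quadratic form `Σ_x Σ_{(μ,ν)} (lcurl φ)²`).  A definition asserting nothing. -/
def curlCurl {Λ : Type*} [Fintype Λ] [DecidableEq Λ] [AddCommGroup Λ] {D : Type*} [Fintype D] [DecidableEq D] (e : D → Λ)
    (p q : Λ × D) : ℝ :=
  ∑ x, ∑ μ, ∑ ν, lcurl e (fun y κ => (Pi.single p (1 : ℝ) : Λ × D → ℝ) (y, κ)) x μ ν *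
    lcurl e (fun y κ => (Pi.single q (1 : ℝ) : Λ × D → ℝ) (y, κ)) x μ ν

/-- [folklore] entries of `siteMul`. -/
@[simp] theorem siteMul_apply {Λ : Type*} {C : Type*} {D : Type*} (ell : Λ → ℝ) (v : Λ × (C × D) → ℝ) (P : Λ × (C × D)) :
    siteMul ell v P = ell P.1 * v P := rfl

end Defs

/-! ## §1 Coordinates, the quadratic-form Ward law, the entrywise law -/

section Coordinates

variable {𝔸 : Type*} [NormedRing 𝔸] [NormedAlgebra ℝ 𝔸]
variable {Λ : Type*} [Fintype Λ] [DecidableEq Λ] [AddCommGroup Λ] {C : Type*} [Fintype C] [DecidableEq C]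
  {D : Type*} [Fintype D] [DecidableEq D] {e : D → Λ}

omit [Fintype Λ] [DecidableEq Λ] [AddCommGroup Λ] [DecidableEq C] [Fintype D] [DecidableEq D] in
/-- [folklore] the coordinate field of the site-weighted coordinates is the site-weighted coordinate field. -/
theorem field_siteMul (t : C → 𝔸) (ell : Λ → ℝ) (v : Λ × (C × D) → ℝ) (x : Λ) (k : D) :
    field t (siteMul ell v) x k = ell x • field t v x k := by
  simp only [field, siteMul_apply, Finset.smul_sum, smul_smul]

omit [Fintype Λ] [DecidableEq Λ] [AddCommGroup Λ] [DecidableEq C] [Fintype D] [DecidableEq D] in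
/-- [folklore] **THE CONJUGATION BY `ℓ • Y` OF THE COORDINATE FIELD** is the commutator of `Y` with the site-weighted coordinate field. -/
theorem adj_smul_field (t : C → 𝔸) (ell : Λ → ℝ) (Y : 𝔸) (v : Λ × (C × D) → ℝ) (x : Λ) (k : D) :
    adj (fun x => ell x • Y) (field t v) x k = Y * field t (siteMul ell v) x k - field t (siteMul ell v) x k * Y := by
  rw [adj_apply, field_siteMul, smul_mul_assoc, mul_smul_comm, mul_smul_comm, smul_mul_assoc]

omit [Fintype Λ] [DecidableEq Λ] [Fintype D] [DecidableEq D] [NormedAlgebra ℝ 𝔸] [Fintype C] [DecidableEq C] in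
/-- [folklore] the curl of a commutator field `x k ↦ Y·G_k(x) − G_k(x)·Y` is the commutator of `Y` with the curl. -/
theorem lcurl_comm_letter (Y : 𝔸) (G : Λ → D → 𝔸) (x : Λ) (μ ν : D) :
    lcurl e (fun x k => Y * G x k - G x k * Y) x μ ν = Y * lcurl e G x μ ν - lcurl e G x μ ν * Y := by
  simp only [lcurl, mul_sub, sub_mul]
  abel

omit [DecidableEq Λ] [DecidableEq C] [DecidableEq D] in
/-- [folklore] **THE RIGHT SIDE OF `jet21_grad` IN COORDINATES**: for `W = field t v`, `λ = ℓ • Y`,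
`Σ_x Σ_μν τ(lcurl W · lcurl (adj λ W)) = −Σ_x Σ_μν Σ_a g_a · Σ_b (adM Y)_{ab} f_b`, `g = lcurl (coords v)`, `f = lcurl (coords (ℓ ⊙ v))`
(`lcurl_field`, `WilsonStencilReflection.trace_comb_mul_comm`). -/
theorem rhs_coords (τ : 𝔸 →ₗ[ℝ] ℝ) (hτ : ∀ a b : 𝔸, τ (a * b) = τ (b * a)) (t : C → 𝔸) (ell : Λ → ℝ) (Y : 𝔸)
    (v : Λ × (C × D) → ℝ) :
    (∑ x, ∑ μ, ∑ ν, τ (lcurl e (field t v) x μ ν * lcurl e (adj (fun x => ell x • Y) (field t v)) x μ ν)) =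
      -∑ x, ∑ μ, ∑ ν, ∑ a, lcurl e (coords v) x μ ν a *
        ∑ b, adM τ t Y a b * lcurl e (coords (siteMul ell v)) x μ ν b := by
  have hadj : adj (fun x => ell x • Y) (field t v) = fun x k => Y * field t (siteMul ell v) x k - field t (siteMul ell v) x k * Y := by
    funext x k; exact adj_smul_field t ell Y v x k
  rw [hadj]
  simp only [lcurl_comm_letter, lcurl_field, trace_comb_mul_comm τ hτ t Y, Finset.sum_neg_distrib]

/-- [folklore] **THE LEFT SIDE OF `jet21_grad` IN COORDINATES**: for `W = field t v`, `λ = ℓ • Y`,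
`jet21 (field t v) (grad e (ℓ • Y)) = −Σ_z Σ_γ (ℓ(z + e_γ) − ℓ z) · v ⬝ᵥ W(z, γ, adM Y) v` (an3's every-background headline
`PlaquetteBackground.actionJet21_eq_wilsonVertexOp`, `adM_smul`, `wilsonVertex₁_smul`). -/
theorem lhs_coords (τ : 𝔸 →ₗ[ℝ] ℝ) (hτ : ∀ a b : 𝔸, τ (a * b) = τ (b * a)) (t : C → 𝔸) (ell : Λ → ℝ) (Y : 𝔸)
    (v : Λ × (C × D) → ℝ) :
    jet21 ℝ τ e (field t v) (grad e (fun x => ell x • Y)) =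
      -∑ z, ∑ γ, (ell (z + e γ) - ell z) * (v ⬝ᵥ (wilsonVertex₁ e z γ (adM τ t Y) *ᵥ v)) := by
  have h := actionJet21_eq_wilsonVertexOp τ hτ t e v (grad e (fun x => ell x • Y))
  have hop : wilsonVertexOp e (fun z γ => adM τ t (grad e (fun x => ell x • Y) z γ)) =
      ∑ z, ∑ γ, (ell (z + e γ) - ell z) • wilsonVertex₁ e z γ (adM τ t Y) := by
    unfold wilsonVertexOp
    refine Finset.sum_congr rfl fun z _ => Finset.sum_congr rfl fun γ _ => ?_
    simp only [grad_apply, ← sub_smul, adM_smul, wilsonVertex₁_smul]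
  rw [hop] at h
  simp only [dotProduct_sum_mulVec, Matrix.smul_mulVec, dotProduct_smul, smul_eq_mul] at h
  linarith

/-- [folklore] **THE QUADRATIC-FORM WARD LAW.**  For every finite lattice, frame, normed algebra, tracial `τ`, letter family `t`, letter
`Y`, scalar site profile `ℓ` and every fluctuation `v` in coordinates:
`Σ_z Σ_γ (ℓ(z + e_γ) − ℓ z) · v ⬝ᵥ W(z, γ, adM Y) v = Σ_x Σ_μν Σ_a (lcurl v)_a · Σ_b (adM Y)_{ab} (lcurl (ℓ ⊙ v))_b` — `jet21_grad` read
in coordinates on both sides. -/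
theorem quadratic_ward_law (τ : 𝔸 →ₗ[ℝ] ℝ) (hτ : ∀ a b : 𝔸, τ (a * b) = τ (b * a)) (t : C → 𝔸) (ell : Λ → ℝ) (Y : 𝔸)
    (v : Λ × (C × D) → ℝ) :
    (∑ z, ∑ γ, (ell (z + e γ) - ell z) * (v ⬝ᵥ (wilsonVertex₁ e z γ (adM τ t Y) *ᵥ v))) =
      ∑ x, ∑ μ, ∑ ν, ∑ a, lcurl e (coords v) x μ ν a * ∑ b, adM τ t Y a b * lcurl e (coords (siteMul ell v)) x μ ν b := by
  have h := jet21_grad ℝ τ hτ e (field t v) (fun x => ell x • Y)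
  rw [lhs_coords τ hτ, rhs_coords τ hτ] at h
  exact neg_injective h

/-! ### the test vectors -/

omit [Fintype Λ] [DecidableEq Λ] [AddCommGroup Λ] [Fintype C] [Fintype D] [DecidableEq D] [NormedRing 𝔸] [NormedAlgebra ℝ 𝔸] in
/-- [folklore] site-weighting a colour-supported vector weights its colourless profile. -/
theorem siteMul_cvec (ell : Λ → ℝ) (a : C) (φ : Λ × D → ℝ) :
    siteMul ell (cvec a φ) = cvec a (fun p => ell p.1 * φ p) := by
  funext P; simp only [siteMul_apply, cvec]; split_ifs <;> simp

omit [Fintype Λ] [DecidableEq Λ] [AddCommGroup Λ] [Fintype C] [DecidableEq C] [Fintype D] [DecidableEq D] [NormedRing 𝔸]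
  [NormedAlgebra ℝ 𝔸] in
/-- [folklore] site-weighting is additive. -/
theorem siteMul_add (ell : Λ → ℝ) (v w : Λ × (C × D) → ℝ) : siteMul ell (v + w) = siteMul ell v + siteMul ell w := by
  funext P; simp only [siteMul_apply, Pi.add_apply, mul_add]

omit [Fintype Λ] [AddCommGroup Λ] [Fintype C] [DecidableEq C] [Fintype D] [NormedRing 𝔸] [NormedAlgebra ℝ 𝔸] in
/-- [folklore] site-weighting a delta profile scales it by the weight of its site. -/
theorem siteMul₀_single (ell : Λ → ℝ) (p : Λ × D) :
    (fun q : Λ × D => ell q.1 * (Pi.single p (1 : ℝ) : Λ × D → ℝ) q) = ell p.1 • (Pi.single p (1 : ℝ) : Λ × D → ℝ) := by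
  funext q
  simp only [Pi.smul_apply, smul_eq_mul, Pi.single_apply]
  split_ifs with h
  · rw [h]
  · rw [mul_zero, mul_zero]

omit [Fintype Λ] [DecidableEq Λ] [Fintype C] [DecidableEq C] [Fintype D] [DecidableEq D] [NormedRing 𝔸] [NormedAlgebra ℝ 𝔸] in
/-- [folklore] the colourless curl of a scaled profile. -/
theorem lcurl₀_smul (c : ℝ) (φ : Λ × D → ℝ) (x : Λ) (μ ν : D) :
    lcurl e (fun y κ => (c • φ) (y, κ)) x μ ν = c * lcurl e (fun y κ => φ (y, κ)) x μ ν := by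
  simp only [lcurl, Pi.smul_apply, smul_eq_mul, mul_sub]

omit [Fintype Λ] [DecidableEq Λ] [AddCommGroup Λ] [Fintype C] [DecidableEq C] [Fintype D] [DecidableEq D] [NormedRing 𝔸]
  [NormedAlgebra ℝ 𝔸] in
/-- [folklore] the coordinates of a sum. -/
theorem coords_add (v w : Λ × (C × D) → ℝ) : coords (v + w) = coords v + coords w := rfl

/-- [folklore] **THE ENTRYWISE WARD LAW WITH COLOUR.**  At the test vector `v = cvec a δ_p + cvec b δ_q` the quadratic-form law reads
`(adM Y)_{ab} · 2 · Σ_z Σ_γ (ℓ(z + e_γ) − ℓ z) · S₀A(z, γ; p, q) = (adM Y)_{ab} · (ℓ q.1 − ℓ p.1) · curlCurl e p q` (the diagonal colour terms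
die by `adM_antisymm`). -/
theorem entry_ward_law_colour (τ : 𝔸 →ₗ[ℝ] ℝ) (hτ : ∀ a b : 𝔸, τ (a * b) = τ (b * a)) (t : C → 𝔸) (ell : Λ → ℝ) (Y : 𝔸)
    (a b : C) (p q : Λ × D) :
    adM τ t Y a b * (2 * ∑ z, ∑ γ, (ell (z + e γ) - ell z) * S₀A e z γ p q) =
      adM τ t Y a b * ((ell q.1 - ell p.1) * curlCurl e p q) := by
  have h := quadratic_ward_law (e := e) τ hτ t ell Y (cvec a (Pi.single p 1) + cvec b (Pi.single q 1))
  have haa : adM τ t Y a a = 0 := by have := adM_antisymm τ t Y a a; linarith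
  have hbb : adM τ t Y b b = 0 := by have := adM_antisymm τ t Y b b; linarith
  have hba : adM τ t Y b a = -adM τ t Y a b := adM_antisymm τ t Y a b
  have h1 : ∀ (S : Matrix (Λ × D) (Λ × D) ℝ) (p' q' : Λ × D),
      (Pi.single p' (1 : ℝ) : Λ × D → ℝ) ⬝ᵥ (S *ᵥ (Pi.single q' (1 : ℝ))) = S p' q' := by
    intro S p' q'
    rw [Matrix.mulVec_single_one, single_one_dotProduct, Matrix.col_apply]
  -- the left side at the test vector, bond by bond
  have hL : ∀ (z : Λ) (γ : D),
      (cvec a (Pi.single p 1) + cvec b (Pi.single q 1)) ⬝ᵥ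
          (wilsonVertex₁ e z γ (adM τ t Y) *ᵥ (cvec a (Pi.single p 1) + cvec b (Pi.single q 1))) =
        adM τ t Y a b * (wilsonStencil₀ e z γ p q - wilsonStencil₀ e z γ q p) := by
    intro z γ
    simp only [Matrix.mulVec_add, dotProduct_add, add_dotProduct, cvec_wilsonVertex₁_cvec, h1, haa, hbb, hba]
    ring
  -- the right side at the test vector, plaquette by plaquette
  have hR : ∀ (x : Λ) (μ ν : D),
      (∑ a', lcurl e (coords (cvec a (Pi.single p 1) + cvec b (Pi.single q 1))) x μ ν a' *
          ∑ b', adM τ t Y a' b' * lcurl e (coords (siteMul ell (cvec a (Pi.single p 1) + cvec b (Pi.single q 1)))) x μ ν b') =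
        adM τ t Y a b * ((ell q.1 - ell p.1) *
          (lcurl e (fun y κ => (Pi.single p (1 : ℝ) : Λ × D → ℝ) (y, κ)) x μ ν *
            lcurl e (fun y κ => (Pi.single q (1 : ℝ) : Λ × D → ℝ) (y, κ)) x μ ν)) := by
    intro x μ ν
    simp only [siteMul_add, siteMul_cvec, siteMul₀_single, coords_add, lcurl_add, Pi.add_apply, lcurl_coords_cvec, lcurl₀_smul,
      add_mul, ite_mul, zero_mul, Finset.sum_add_distrib, Finset.sum_ite_eq', Finset.mem_univ, if_true, mul_add, mul_ite, mul_zero,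
      haa, hbb, hba]
    ring
  simp only [hL, hR] at h
  have e1 : adM τ t Y a b * (2 * ∑ z, ∑ γ, (ell (z + e γ) - ell z) * S₀A e z γ p q) =
      ∑ z, ∑ γ, (ell (z + e γ) - ell z) * (adM τ t Y a b * (wilsonStencil₀ e z γ p q - wilsonStencil₀ e z γ q p)) := by
    unfold S₀A
    simp only [Finset.mul_sum]
    refine Finset.sum_congr rfl fun z _ => Finset.sum_congr rfl fun γ _ => ?_
    ring
  have e2 : adM τ t Y a b * ((ell q.1 - ell p.1) * curlCurl e p q) =
      ∑ x, ∑ μ, ∑ ν, adM τ t Y a b * ((ell q.1 - ell p.1) *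
        (lcurl e (fun y κ => (Pi.single p (1 : ℝ) : Λ × D → ℝ) (y, κ)) x μ ν *
          lcurl e (fun y κ => (Pi.single q (1 : ℝ) : Λ × D → ℝ) (y, κ)) x μ ν)) := by
    unfold curlCurl
    simp only [Finset.mul_sum]
  rw [e1, e2]
  exact h

/-! ### the curl–curl matrix is twice the contact coefficient -/

omit [Fintype Λ] [AddCommGroup Λ] [Fintype D] in
/-- [folklore] a delta profile on `Λ × D` is the one-bond letter `1`. -/
theorem single_eq_bondLetter (p : Λ × D) :
    (fun y κ => (Pi.single p (1 : ℝ) : Λ × D → ℝ) (y, κ)) = bondLetter p.1 p.2 (1 : ℝ) := by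
  funext y κ
  simp only [Pi.single_apply, bondLetter, Prod.ext_iff]

omit [Fintype D] in
/-- [folklore] pairing a plaquette function with the curl of a one-bond letter collapses the site sum onto the bond's plaquettes:
`Σ_x F x μ ν · lcurl δ_{(u,α)} (x;μ,ν) = [ν = α]·(F (u − e_μ) μ ν − F u μ ν) − [μ = α]·(F (u − e_ν) μ ν − F u μ ν)`. -/
theorem sum_mul_lcurl_bondLetter (F : Λ → D → D → ℝ) (u : Λ) (α μ ν : D) :
    (∑ x, F x μ ν * lcurl e (bondLetter u α (1 : ℝ)) x μ ν) =
      (if ν = α then F (u - e μ) μ ν - F u μ ν else 0) - (if μ = α then F (u - e ν) μ ν - F u μ ν else 0) := by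
  have key : ∀ (w : Λ) (κ : D), (∑ x, F x μ ν * bondLetter u α (1 : ℝ) (x + w) κ) = if κ = α then F (u - w) μ ν else 0 := by
    intro w κ
    by_cases hκ : κ = α
    · rw [if_pos hκ]
      have hx : ∀ x, F x μ ν * bondLetter u α (1 : ℝ) (x + w) κ = if x = u - w then F x μ ν else 0 := by
        intro x
        simp only [bondLetter, hκ, and_true, mul_ite, mul_one, mul_zero, ← eq_sub_iff_add_eq]
      simp only [hx, Finset.sum_ite_eq', Finset.mem_univ, if_true]
    · rw [if_neg hκ]
      refine Finset.sum_eq_zero fun x _ => ?_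
      simp only [bondLetter, hκ, and_false, if_false, mul_zero]
  have key0 : ∀ κ : D, (∑ x, F x μ ν * bondLetter u α (1 : ℝ) x κ) = if κ = α then F u μ ν else 0 := by
    intro κ
    have h := key 0 κ
    simp only [add_zero, sub_zero] at h
    exact h
  simp only [lcurl, mul_sub, Finset.sum_sub_distrib, key, key0]
  by_cases hν : ν = α <;> by_cases hμ : μ = α <;> simp only [hν, hμ, if_true, if_false] <;> ring

/-- [folklore] **THE CURL–CURL MATRIX IS TWICE an3's CONTACT COEFFICIENT**: `curlCurl e p q = 2 · Lc e q.2 q.1 p` (the two Kronecker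
sums of the column's curl fold into one by the antisymmetry `lcurl_swap`). -/
theorem curlCurl_eq_two_mul_Lc (p q : Λ × D) : curlCurl e p q = 2 * Lc e q.2 q.1 p := by
  obtain ⟨u, α⟩ := q
  unfold curlCurl Lc
  rw [single_eq_bondLetter p, single_eq_bondLetter (u, α)]
  dsimp only
  set F : Λ → D → D → ℝ := fun x μ ν => lcurl e (bondLetter p.1 p.2 (1 : ℝ)) x μ ν with hF
  have hanti : ∀ x μ ν, F x ν μ = -F x μ ν := fun x μ ν => lcurl_swap e _ x μ ν
  have h1 : (∑ x, ∑ μ, ∑ ν, F x μ ν * lcurl e (bondLetter u α (1 : ℝ)) x μ ν) =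
      ∑ μ, ∑ ν, ((if ν = α then F (u - e μ) μ ν - F u μ ν else 0) - (if μ = α then F (u - e ν) μ ν - F u μ ν else 0)) := by
    rw [Finset.sum_comm]
    refine Finset.sum_congr rfl fun μ _ => ?_
    rw [Finset.sum_comm]
    refine Finset.sum_congr rfl fun ν _ => ?_
    exact sum_mul_lcurl_bondLetter F u α μ ν
  have hA : (∑ μ, ∑ ν, (if ν = α then F (u - e μ) μ ν - F u μ ν else (0 : ℝ))) = ∑ μ, (F (u - e μ) μ α - F u μ α) := by
    refine Finset.sum_congr rfl fun μ _ => ?_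
    rw [Finset.sum_ite_eq' Finset.univ α, if_pos (Finset.mem_univ _)]
  have hB : (∑ μ, ∑ ν, (if μ = α then F (u - e ν) μ ν - F u μ ν else (0 : ℝ))) = ∑ ν, (F (u - e ν) α ν - F u α ν) := by
    rw [Finset.sum_comm]
    refine Finset.sum_congr rfl fun ν _ => ?_
    rw [Finset.sum_ite_eq' Finset.univ α, if_pos (Finset.mem_univ _)]
  have hB' : (∑ ν, (F (u - e ν) α ν - F u α ν)) = -∑ ν, (F (u - e ν) ν α - F u ν α) := by
    rw [← Finset.sum_neg_distrib]
    refine Finset.sum_congr rfl fun ν _ => ?_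
    rw [hanti (u - e ν) ν α, hanti u ν α]; ring
  have h2 : (∑ μ, ∑ ν, ((if ν = α then F (u - e μ) μ ν - F u μ ν else (0 : ℝ)) -
      (if μ = α then F (u - e ν) μ ν - F u μ ν else 0))) =
      (∑ μ, ∑ ν, (if ν = α then F (u - e μ) μ ν - F u μ ν else (0 : ℝ))) -
        ∑ μ, ∑ ν, (if μ = α then F (u - e ν) μ ν - F u μ ν else (0 : ℝ)) := by
    rw [← Finset.sum_sub_distrib]
    exact Finset.sum_congr rfl fun μ _ => Finset.sum_sub_distrib _ _
  rw [h1, h2, hA, hB, hB']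
  ring

end Coordinates

/-! ### the colourless law -/

section Colourless

/-- [folklore] **THE WARD (DIVERGENCE) LAW OF THE ANTISYMMETRISED WILSON STENCIL, smeared form (entrywise, colourless).**  On every finite
abelian lattice `Λ` with frame `e : D → Λ`, for every scalar site profile `ℓ` and all bonds `p q`:
`Σ_z Σ_γ (ℓ(z + e_γ) − ℓ z) · S₀A e z γ p q = (ℓ q.1 − ℓ p.1) · Lc e q.2 q.1 p` — the antisymmetric part of `WilsonVertexKron.wilsonStencil₀`
contracted with the pure gauge `grad ℓ` on its background bond is the commutator of the curl–curl form with the multiplication by `ℓ`,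
coefficient one half of the curl–curl entry `2·Lc`.  Proof: `entry_ward_law_colour` at the quaternion witness
`WilsonStencilReflection.adM_witnessH` and `curlCurl_eq_two_mul_Lc`. -/
theorem S₀A_grad {Λ : Type*} [Fintype Λ] [DecidableEq Λ] [AddCommGroup Λ] {D : Type*} [Fintype D] [DecidableEq D] (e : D → Λ)
    (ell : Λ → ℝ) (p q : Λ × D) :
    (∑ z, ∑ γ, (ell (z + e γ) - ell z) * S₀A e z γ p q) = (ell q.1 - ell p.1) * Lc e q.2 q.1 p := by
  have h := entry_ward_law_colour (e := e) τH τH_comm tH ell YH 0 1 p q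
  rw [adM_witnessH, one_mul, one_mul, curlCurl_eq_two_mul_Lc] at h
  linear_combination (1 / 2 : ℝ) * h

/-- [folklore] **THE WARD (DIVERGENCE) LAW OF THE ANTISYMMETRISED WILSON STENCIL AT ONE SITE (entrywise, colourless).**  For every site `u`
and all bonds `p q`:  `Σ_γ (S₀A e (u − e_γ) γ p q − S₀A e u γ p q) = ([q.1 = u] − [p.1 = u]) · Lc e q.2 q.1 p` — the response of the
antisymmetric Wilson stencil to the pure-gauge background `grad δ_u` (the first-order background variation of an2's `KernelWard.divV`) is the
generator of the gauge rotation at `u` acting on the two legs AT THEIR SITES, through the curl–curl contact `Lc`. -/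
theorem S₀A_div {Λ : Type*} [Fintype Λ] [DecidableEq Λ] [AddCommGroup Λ] {D : Type*} [Fintype D] [DecidableEq D] (e : D → Λ)
    (u : Λ) (p q : Λ × D) :
    (∑ γ, (S₀A e (u - e γ) γ p q - S₀A e u γ p q)) =
      ((if q.1 = u then 1 else 0) - (if p.1 = u then 1 else 0)) * Lc e q.2 q.1 p := by
  have h := S₀A_grad e (fun x => if x = u then (1 : ℝ) else 0) p q
  rw [← h, Finset.sum_comm]
  refine Finset.sum_congr rfl fun γ _ => ?_
  have hsplit : ∀ z : Λ, ((if z + e γ = u then (1 : ℝ) else 0) - if z = u then 1 else 0) * S₀A e z γ p q =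
      (if z = u - e γ then S₀A e z γ p q else 0) - (if z = u then S₀A e z γ p q else 0) := by
    intro z
    simp only [← eq_sub_iff_add_eq]
    split_ifs <;> ring
  simp only [hsplit, Finset.sum_sub_distrib, Finset.sum_ite_eq', Finset.mem_univ, if_true]

end Colourless

end Summit.QuantumFields.BalabanUV.Beta.WilsonStencilDivergence
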